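import Mathlib
import Summits.ValiantsHypothesis.ValiantsHypothesis.Theorems.GrenetZeonDualUnipotentThreeHalvesFlagCostRunBound
import Literature.LinearAlgebra.GMSPermanentalRankSubspace
import Literature.LinearAlgebra.GMSPermanentalRankSubspaceHolds
import Summits.ValiantsHypothesis.ValiantsHypothesis.Theses.GrenetZeon
import Summits.ValiantsHypothesis.ValiantsHypothesis.Theorems.GrenetZeonDualUnipotentThreeHalvesPermRankOfLineFlat
import Summits.ValiantsHypothesis.ValiantsHypothesis.Theorems.DualUnipotentThreeHalves.Negative.FlagCheapIndexBound
import Summits.ValiantsHypothesis.ValiantsHypothesis.Theorems.DualUnipotentThreeHalves.Negative.FlagCheapOfTriangularisable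
import Summits.ValiantsHypothesis.ValiantsHypothesis.Theorems.DualUnipotentThreeHalves.Negative.FlagCheapOfTopIndex
import Summits.ValiantsHypothesis.ValiantsHypothesis.Theorems.GrenetZeonTwoDimCoefficientsDefs
import Summits.ValiantsHypothesis.ValiantsHypothesis.Theorems.GrenetZeonTwoDimCoefficientsDualUnipotentNormalForm
import Summits.ValiantsHypothesis.ValiantsHypothesis.Theorems.GrenetZeonTwoDimCoefficientsDualUnipotentTriangular

/-!
# Line `flag_cost` for the crux `GrenetZeon.DualUnipotentThreeHalves` (stmt-ValiantsHypothesis-24318)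

val-idea-9 g3 (negation lens).  A TYPED SPLIT of the LAW-tier stub S3 `SlowPlane` of the line
`slow_planes` (crit-3 VERDICT #14: PASS-WITH-PRICE; «S3 = LAW, 0 provers until a mechanism for
non-triangularisable 𝒱 is named — day-1 object: an invariant of a nilpotent space that lower-bounds the
cheapest (codim, k) pair, e.g. via a flag of kernels / socle filtration»).  This file NAMES and TYPES that
invariant and PROVES the half of S3 that it controls.

LEVER (the named mechanism): a POTENTIAL ON A FLAG.  Fix levels `lvl : Fin m → ℕ` with `lvl < p`, a
drop `r` and a climb weight `a+1`.  A matrix `M(s)` of one-variable polynomials is ADAPTED if the `s^e`-part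
of its `(i,j)` entry is nonzero only when `(a+1)·e + lvl j ≤ lvl i + r` (constant part drops levels by `≤ r`,
`s`-part climbs by `≥ a+1-r`).  Then along every path the potential bookkeeping gives, for every power,
`coeff_{s^e} (M^L)_{ij} ≠ 0 ⇒ (a+1)·e + lvl j ≤ lvl i + r·L` (`coeff_pow_of_flagAdapted`, induction on `L`),
hence every entry of `M^{n-1}` has `s`-degree `≤ flagDeg p r a n := ⌊(p-1+r(n-1))/(a+1)⌋`, and the bound
is invariant under constant change of basis.  Consequently (`runBound_proof`, sorry-free):

  **S3a (RUN BOUND, PROVED).**  `FlagCheap n m N → slow plane for N`, where `FlagCheap` asks for a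
  direction space `K` and an order `k` such that along every line `x + s v`, `v ∈ K`, the substituted
  pencil is — after a constant change of basis that may depend on the line — adapted to SOME flag with
  `flagDeg ≤ k`, and `(k+1)·n < dim K`.

Every census pass of `slow_planes` is an instance of ONE uniform flag:
* trivial regime (crit-3): `K = ker N_lin`, `p = 1`, `r = a = 0`, `k = 0`;
* simultaneously triangularisable pencils: coarsen the full flag into `p` blocks, `r = a = 0`, `k = p-1`,
  `codim ≤ m²/(2p)` ⇒ slow plane iff `m² < n³/2` (`C₀ = 2`);
* `L_k = S⊗M_k + R⊗ℂI + E₂₃⊗𝔫_k` and all return-fattenings / `E₂₃⊗𝒩` extensions / bi-commutants `B(a,b)`: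
  the 3-block flag, `K = {returns = 0}` (codim 1, resp. `b²`), returns drop ONE level: `p = 3`, `r = a = 1`,
  `k = ⌊(n+1)/2⌋` — exactly the critic's computation in VERDICT #14 (i), now a corollary;
* `S_p`-skeletons `⊗ M_k` with returns dropping `r` levels: `k = ⌊(p-1+r(n-1))/(r+1)⌋`, speed `r/(r+1) < 1`;
* any climber subspace `W ≤ 𝒱` generating an associative algebra of nilpotency index `≤ p`, base pencil
  unconstrained: image flag `ℂ^m ⊋ Wℂ^m ⊋ W²ℂ^m ⊋ …`, `r = a = p-1`, `k = ⌊(p-1)n/p⌋`.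
WEDDERBURN REDUCTION (card §3): for `𝒜 = Alg(ℂN₀ + 𝒱)` with radical `J`, the Loewy flag `J^iℂ^m` is
preserved by the WHOLE pencil (`r = 0`) and climbed by `𝒱 ∩ J` for free; so a counterexample to S3b must
carry its cost on the semisimple top, i.e. on IRREDUCIBLE nilpotent spaces `𝒱̄_j ⊂ M_{d_j}` (Burnside),
expensive for every NON-invariant flag (`r ≥ 1`).  That is where located-A now points.

  **S3b (FLAG-COST LAW, stub = the residual crux of this line).**  Every affine nilpotent pencil of width
  `m` with `C₀ m² < n³` is flag-cheap.  Per-agnostic; content only for coefficient spaces of dimension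
  `δ ∈ [n²-n, n²]` (below: trivial regime).  Why it might fail: a nilpotent space with `δ ≈ m^{4/3}` whose
  irreducible top is expensive for every bounded-drop flag, OR a pencil that is slow only through
  characteristic-zero CANCELLATIONS (then S3b is false while S3 may survive — informative either way).

STUBS (registered targets): `stub_permRank_of_lineFlat` (S1, folklore, M), `stub_gms` (S2, GMS 2023
Cor. 1.6, L), `stub_flagCostLaw` (S3b, LAW).  PROVED here: `runBound_proof` (S3a), `slowPlane_of_flagCost`,
and the composition `dualUnipotentThreeHalves_of : S1 → S2 → S3a → S3b → GrenetZeon.DualUnipotentThreeHalves`.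

§0 is a VERBATIM copy of the interface of `Lines/slow_planes.lean` (`lineSubst`, S1, S2, `SlowPlane`, the
composition through `SlowPlane`): Cruxes workfiles are not importable on the farm (lean check answers
`remote:stale:unbuilt` for `…Cruxes.….Lines.slow_planes`), and the normalised signatures are identical, so
the items are the same items.

VP ≠ VNP is not moved by this line; GrenetZeon / 24318 is a restricted-model rung.  Nothing here asserts
24318, 8062, S3 or S3b.
-/

set_option linter.dupNamespace false

noncomputable section

namespace Summit.ValiantsHypothesis.ValiantsHypothesis.Cruxes.DualUnipotentThreeHalves.FlagCost

open MvPolynomial Matrix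
open scoped BigOperators
open Literature.Computability.AlgebraicComplexity
open Summit.ValiantsHypothesis.ValiantsHypothesis.Cruxes.TwoDimCoefficients.DimTwoCases
open Summit.ValiantsHypothesis.ValiantsHypothesis.Theses.GrenetZeon (DualUnipotentThreeHalves)

/-! ## §0 Interface shared with `slow_planes` (verbatim) -/

/-- The substitution `X_c ↦ x_c + v_c · s` into one-variable polynomials (`s = X 0`). -/
def lineSubst {σ : Type*} (x v : σ → ℂ) : MvPolynomial σ ℂ →ₐ[ℂ] MvPolynomial (Fin 1) ℂ :=
  aeval fun c => (C (x c) + ∑ t : Fin 1, C (v c) * X t : MvPolynomial (Fin 1) ℂ)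

theorem lineSubst_eq {σ : Type*} (x v : σ → ℂ) :
    lineSubst x v = aeval fun c => (C (x c) + ∑ t : Fin (0 + 1), C ((fun _ : Fin (0 + 1) => v) t c) * X t :
      MvPolynomial (Fin (0 + 1)) ℂ) := rfl

/-- Affine entries stay affine along a line. -/
theorem totalDegree_lineSubst_le_one {σ : Type*} [Fintype σ] (x v : σ → ℂ) {g : MvPolynomial σ ℂ}
    (hg : g.totalDegree ≤ 1) : (lineSubst x v g).totalDegree ≤ 1 := by
  rw [lineSubst_eq]
  exact totalDegree_aeval_line_le_one x (fun _ : Fin (0 + 1) => v) hg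

/-- `v` has permanental rank `≤ k`: all its `(k+1) × (k+1)` subpermanents vanish. -/
def PermRankLE (n k : ℕ) (v : Fin n × Fin n → ℂ) : Prop :=
  ∀ (r c : Fin (k + 1) ↪ Fin n), (Matrix.of fun i j => v (r i, c j)).permanent = 0

/-- `K` is LINE-FLAT of order `k` for `per_n`. -/
def LineFlat (n k : ℕ) (K : Submodule ℂ (Fin n × Fin n → ℂ)) : Prop :=
  ∀ x v : Fin n × Fin n → ℂ, v ∈ K → (lineSubst x v (perPoly (Fin n) ℂ)).totalDegree ≤ k

/-- **S1 (per-specific, folklore, size M)** — identical to `SlowPlanes.PermRankOfLineFlat`. -/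
def PermRankOfLineFlat : Prop :=
  ∀ (n k : ℕ) (K : Submodule ℂ (Fin n × Fin n → ℂ)), LineFlat n k K → ∀ v ∈ K, PermRankLE n k v

/-- **S2 (GUTERMAN–MESHULAM–SPIRIDONOV 2023, Cor. 1.6; arXiv:2212.11193; size L)** — identical to
`SlowPlanes.GMSBound`. -/
def GMSBound : Prop :=
  ∀ (n k : ℕ) (K : Submodule ℂ (Fin n × Fin n → ℂ)), (∀ v ∈ K, PermRankLE n k v) → Module.finrank ℂ K ≤ k * n

/-- **S3 — SLOW PLANE** — identical to `SlowPlanes.SlowPlane`; in THIS line it is a proved consequence of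
S3a + S3b (`slowPlane_of_flagCost`), not a stub. -/
def SlowPlane : Prop :=
  ∃ C₀ n₀ : ℕ, ∀ n ≥ n₀, ∀ m : ℕ, C₀ * m ^ 2 < n ^ 3 → ∀ N : AffMat n m, IsAffine N → N ^ m = 0 →
    ∃ (K : Submodule ℂ (Fin n × Fin n → ℂ)) (k : ℕ),
      (∀ x v : Fin n × Fin n → ℂ, v ∈ K → ∀ i j : Fin m, (((N.map (lineSubst x v)) ^ (n - 1)) i j).totalDegree ≤ k) ∧
      (k + 1) * n < Module.finrank ℂ K

/-! ## §1 Flags, potentials, and the two halves of S3 -/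

/-- Degree budget of a flag with `p` levels, drop `r`, climb weight `a+1`, over words of length `n-1`. -/
def flagDeg (p r a n : ℕ) : ℕ := (p - 1 + r * (n - 1)) / (a + 1)

/-- `M(s)` is ADAPTED to the levels `lvl` with drop `r` and weight `a+1`: the `s^e`-part of the `(i,j)` entry
is nonzero only if `(a+1)·e + lvl j ≤ lvl i + r`.  (`e = 0`: the constant part lowers the level by at most
`r`; `e = 1`: the linear part raises it by at least `a+1-r`; for the census instances `a = r`, climb `1`.) -/
def FlagAdapted {m : ℕ} (lvl : Fin m → ℕ) (r a : ℕ) (M : Matrix (Fin m) (Fin m) (MvPolynomial (Fin 1) ℂ)) :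
    Prop :=
  ∀ (i j : Fin m) (d : Fin 1 →₀ ℕ), coeff d (M i j) ≠ 0 → (a + 1) * d 0 + lvl j ≤ lvl i + r

/-- `M(s)` is adapted, after a constant change of basis, to SOME flag of degree budget `≤ k`. -/
def FlagAdaptedUpTo (m k n : ℕ) (M : Matrix (Fin m) (Fin m) (MvPolynomial (Fin 1) ℂ)) : Prop :=
  ∃ (g : (Matrix (Fin m) (Fin m) ℂ)ˣ) (lvl : Fin m → ℕ) (p r a : ℕ),
    (∀ i, lvl i < p) ∧ flagDeg p r a n ≤ k ∧
    FlagAdapted lvl r a ((g : Matrix (Fin m) (Fin m) ℂ).map C * M * (↑g⁻¹ : Matrix (Fin m) (Fin m) ℂ).map C)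

/-- The pencil `N` is FLAG-CHEAP: some direction space `K` and order `k` with `(k+1)·n < dim K` such that
along every line `x + s v`, `v ∈ K`, the substituted pencil is adapted (up to a constant change of basis that
may depend on the line) to a flag of budget `≤ k`.  The INVARIANT of the verdict is
`κ(N) := min over (K, flags) of codim K + (k+1)·n`; flag-cheap means `κ(N) < n²`. -/
def FlagCheap (n m : ℕ) (N : AffMat n m) : Prop :=
  ∃ (K : Submodule ℂ (Fin n × Fin n → ℂ)) (k : ℕ),
    (∀ x v : Fin n × Fin n → ℂ, v ∈ K → FlagAdaptedUpTo m k n (N.map (lineSubst x v))) ∧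
    (k + 1) * n < Module.finrank ℂ K

/-- **S3a — RUN BOUND** (per-agnostic, PROVED below as `runBound_proof`): flag-cheap ⇒ slow plane. -/
def RunBound : Prop :=
  ∀ (n m : ℕ) (N : AffMat n m), FlagCheap n m N →
    ∃ (K : Submodule ℂ (Fin n × Fin n → ℂ)) (k : ℕ),
      (∀ x v : Fin n × Fin n → ℂ, v ∈ K → ∀ i j : Fin m, (((N.map (lineSubst x v)) ^ (n - 1)) i j).totalDegree ≤ k) ∧
      (k + 1) * n < Module.finrank ℂ K

/-- **S3b — FLAG-COST LAW** (per-agnostic; THE residual crux of this line; LAW tier).  Every affine nilpotent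
`m × m` pencil over `Mat_n(ℂ)` with `C₀·m² < n³` is flag-cheap.  TRUE on every family of the wild census
(one uniform flag each, see the module docstring); content only for coefficient spaces of dimension
`δ ≥ n² - n`.  Why it might fail: an irreducible-top-heavy nilpotent space at `δ ≈ m^{4/3}` expensive for every
bounded-drop flag, or a pencil slow only by cancellation. [this line; MOR 1991; crit-3 #9/#14; GMS 2023] -/
def FlagCostLaw : Prop :=
  ∃ C₀ n₀ : ℕ, ∀ n ≥ n₀, ∀ m : ℕ, C₀ * m ^ 2 < n ^ 3 → ∀ N : AffMat n m, IsAffine N → N ^ m = 0 →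
    FlagCheap n m N

/-! ## §2b (placed before the stubs since the S2 discharge) S2 from the landed Literature fact, BY NAME (val-idea-9 g3, 09:11Z; fact DISCHARGED p622922 09:53Z)
`Literature.LinearAlgebra.GutermanMeshulamSpiridonov2023_cor_1_6` (p619424 @eb90aa6b1e0b, port hand val-port-1 g1, lit VET g16;
typed OPEN — Cor. 1.6 of arXiv:2212.11193 is NOT proved in the tree, so `stub_gms` above keeps its `sorry`): the fact is
stated with the tree's permanental rank `BoraleviCarliniMichalekVentura2025.prk`; the two theorems below are the sorry-free
bookkeeping bridge to this line's `GMSBound` (embedding form of "prk ≤ k"), so that the line is conditional on the fact BY NAME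
(`dualUnipotentThreeHalves_of_fact`, end of file). -/

/-- `PermRankLE n k v` (all `(k+1) × (k+1)` subpermanents along injections vanish) ⇒ the tree's permanental rank of the
matrix `(v (i,j))` is `≤ k` — via `forall_rsubperm_eq_zero_iff_prk_lt` and `Matrix.subperm_eq_permanent_of_equiv`. -/
theorem prk_le_of_permRankLE {n k : ℕ} {v : Fin n × Fin n → ℂ} (h : PermRankLE n k v) :
    Literature.Computability.AlgebraicComplexity.BoraleviCarliniMichalekVentura2025.prk
      (Matrix.of fun i j : Fin n => v (i, j)) ≤ k := by
  classical
  set A : Matrix (Fin n) (Fin n) ℂ := Matrix.of fun i j : Fin n => v (i, j) with hA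
  have hlt : Literature.Computability.AlgebraicComplexity.BoraleviCarliniMichalekVentura2025.prk A < k + 1 := by
    rw [← Literature.Computability.AlgebraicComplexity.BoraleviCarliniMichalekVentura2025.forall_rsubperm_eq_zero_iff_prk_lt
      A (h := k + 1) (by omega)]
    intro Rw Cl hR hC
    have eR : Fin (k + 1) ≃ {j // j ∈ Rw} :=
      (Finset.equivFinOfCardEq hR).symm.trans (Equiv.subtypeEquivRight (fun _ => Iff.rfl))
    have eC : Fin (k + 1) ≃ {i // i ∈ Cl} :=
      (Finset.equivFinOfCardEq hC).symm.trans (Equiv.subtypeEquivRight (fun _ => Iff.rfl))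
    rw [Literature.Computability.AlgebraicComplexity.BoraleviCarliniMichalekVentura2025.rsubperm_eq_subperm,
      Matrix.subperm_eq_permanent_of_equiv A eC eR]
    let r : Fin (k + 1) ↪ Fin n := ⟨fun a => (eR a : Fin n), fun a b hab => eR.injective (Subtype.ext hab)⟩
    let c : Fin (k + 1) ↪ Fin n := ⟨fun a => (eC a : Fin n), fun a b hab => eC.injective (Subtype.ext hab)⟩
    have hmat : (Matrix.of fun a b => A (eR a : Fin n) (eC b : Fin n)) = Matrix.of fun i j => v (r i, c j) := by
      ext a b; simp [hA, r, c]
    rw [hmat]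
    exact h r c
  omega

/-- **S2 BY NAME**: the landed Literature fact (GMS 2023 Cor. 1.6 over `ℂ`, tree-`prk` form) implies this line's
`GMSBound` — transport along `LinearEquiv.curry` and `prk_le_of_permRankLE`. Sorry-free. -/
theorem gmsBound_of_fact (hF : Literature.LinearAlgebra.GutermanMeshulamSpiridonov2023_cor_1_6 ℂ) : GMSBound := by
  classical
  intro n k K hK
  let e : (Fin n × Fin n → ℂ) ≃ₗ[ℂ] Matrix (Fin n) (Fin n) ℂ :=
    (LinearEquiv.curry ℂ ℂ (Fin n) (Fin n)).trans (LinearEquiv.refl ℂ _)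
  have hW : ∀ A ∈ K.map (e : (Fin n × Fin n → ℂ) →ₗ[ℂ] Matrix (Fin n) (Fin n) ℂ),
      Literature.Computability.AlgebraicComplexity.BoraleviCarliniMichalekVentura2025.prk A ≤ k := by
    intro A hA
    obtain ⟨v, hv, rfl⟩ := Submodule.mem_map.1 hA
    have : (e : (Fin n × Fin n → ℂ) →ₗ[ℂ] _) v = Matrix.of fun i j : Fin n => v (i, j) := by
      ext i j; rfl
    rw [this]
    exact prk_le_of_permRankLE (hK v hv)
  have := hF n k (K.map (e : (Fin n × Fin n → ℂ) →ₗ[ℂ] Matrix (Fin n) (Fin n) ℂ)) hW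
  rwa [LinearEquiv.finrank_map_eq] at this

/-! ## §2 Registered stubs -/

theorem stub_permRank_of_lineFlat : PermRankOfLineFlat := by
  -- LANDED (`…Theorems.GrenetZeonDualUnipotentThreeHalvesPermRankOfLineFlat`, `GrenetZeon.SlowPlanes.permRank_of_lineFlat`,
  -- S1 with LineFlat/lineSubst/PermRankLE unfolded verbatim): by-name citation, δ-unfold (port hand val-port-1 g1, val-lit RULING #254 (b)(iv)).
  exact Summit.ValiantsHypothesis.ValiantsHypothesis.Theorems.GrenetZeon.SlowPlanes.permRank_of_lineFlat
theorem stub_gms : GMSBound :=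
  -- S2 is a THEOREM by name: the Literature fact `Literature.LinearAlgebra.GutermanMeshulamSpiridonov2023_cor_1_6` was
  -- DISCHARGED (p622922 `Literature/LinearAlgebra/GMSPermanentalRankSubspaceHolds.lean :: …_cor_1_6_holds`, val-lit-p9 g1,
  -- [paper:arxiv-2212.11193 §2]) and §2b's sorry-free bridge `gmsBound_of_fact` converts it to this line's `GMSBound`.
  gmsBound_of_fact (Literature.LinearAlgebra.GutermanMeshulamSpiridonov2023_cor_1_6_holds ℂ)

theorem stub_flagCostLaw : FlagCostLaw := by
  sorry

/-! ## §3 S3a (the run bound) — LANDED as a Theorems theorem, cited BY NAME (δ-unfold)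
p621562 `Theorems/GrenetZeonDualUnipotentThreeHalvesFlagCostRunBound.lean` (port hand val-port-1 g1, desk RULING #272 (c)/#273 (e),
credit this line): `…Theorems.GrenetZeon.FlagCost.runBound` with the helpers `coeff_pow_of_flagAdapted` (potential bookkeeping:
`coeff_{s^e} (M^L)_{ij} ≠ 0 ⇒ (a+1)·e + lvl j ≤ lvl i + r·L`), `totalDegree_pow_le_flagDeg`, `conj_pow_eq`, `totalDegree_conj_le`, and
`slowPlane_of_runBound_flagCostLaw`; statements = this file's defs UNFOLDED token-for-token.  The in-file proofs (rev ≤ @ee0357ae2957 /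
@36421954d9b5) are superseded by the citation below. -/

/-- **S3a holds** — by name from the Theorems file (sorry-free). -/
theorem runBound_proof : RunBound :=
  Summit.ValiantsHypothesis.ValiantsHypothesis.Theorems.GrenetZeon.FlagCost.runBound

/-- S3a + S3b ⇒ S3. -/
theorem slowPlane_of_flagCost (ha : RunBound) (hb : FlagCostLaw) : SlowPlane := by
  obtain ⟨C₀, n₀, h⟩ := hb
  exact ⟨C₀, n₀, fun n hn m hm N hN hnil => ha n m N (h n hn m hm N hN hnil)⟩

/-! ## §4 Composition (sorry-free) -/

/-- Degree of the pulled-back trace product: entries of `N'^d` of degree `≤ k`, `M` affine ⇒ `≤ k + 1`. -/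
theorem totalDegree_lineSubst_trace_le {n m d k : ℕ} (N M : AffMat n m) (hM : IsAffine M)
    (x v : Fin n × Fin n → ℂ)
    (hdeg : ∀ i j : Fin m, (((N.map (lineSubst x v)) ^ d) i j).totalDegree ≤ k) :
    (lineSubst x v ((N ^ d * M).trace)).totalDegree ≤ k + 1 := by
  set θ := lineSubst x v with hθ
  have hmap : θ ((N ^ d * M).trace) = ((N.map θ) ^ d * M.map θ).trace := by
    rw [show N.map θ = θ.toRingHom.mapMatrix N from rfl,
      show M.map θ = θ.toRingHom.mapMatrix M from rfl, ← map_pow, ← map_mul]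
    simp only [Matrix.trace, Matrix.diag_apply, map_sum, RingHom.mapMatrix_apply, Matrix.map_apply]
    rfl
  rw [hmap, Matrix.trace]
  simp only [Matrix.diag_apply, Matrix.mul_apply]
  have hbound : ∀ i j : Fin m, (((N.map θ) ^ d) i j * (M.map θ) j i).totalDegree ≤ k + 1 := by
    intro i j
    have h1 := hdeg i j
    have h2 : ((M.map θ) j i).totalDegree ≤ 1 := by
      rw [Matrix.map_apply]; exact totalDegree_lineSubst_le_one x v (hM j i)
    have h3 := totalDegree_mul (((N.map θ) ^ d) i j) ((M.map θ) j i)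
    omega
  refine (totalDegree_finsetSum _ _).trans (Finset.sup_le fun i _ => ?_)
  exact (totalDegree_finsetSum _ _).trans (Finset.sup_le fun j _ => hbound i j)

/-- Through `SlowPlane` (verbatim from `slow_planes`). -/
theorem dualUnipotentThreeHalves_of_slowPlane (h1 : PermRankOfLineFlat) (h2 : GMSBound) (h3 : SlowPlane) :
    DualUnipotentThreeHalves := by
  obtain ⟨C₀, n₀, hC⟩ := h3
  refine ⟨C₀, n₀ + 1, ?_⟩
  intro n hn m hrep
  have hrep' : DualUnipotentRepr n m := hrep
  have hn1 : 1 ≤ n := by omega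
  by_contra hlt
  have hlt' : C₀ * m ^ 2 < n ^ 3 := by omega
  obtain ⟨N, M, hN, hM, hnil, hper⟩ := exists_nilpotent_pencil_of_dualUnipotentRepr hn1 hrep'
  have haffN : IsAffine N := fun i j => (hN i j).totalDegree_le
  have haffM : IsAffine M := fun i j => (hM i j).totalDegree_le
  obtain ⟨K, k, hdeg, hdim⟩ := hC n (by omega) m hlt' N haffN hnil
  have hflat : LineFlat n (k + 1) K := by
    intro x v hv
    rw [hper]
    exact totalDegree_lineSubst_trace_le N M haffM x v (hdeg x v hv)
  have hrk := h1 n (k + 1) K hflat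
  have hfin := h2 n (k + 1) K hrk
  omega

/-- **The line.**  S1 + S2 (per-specific) + S3a (proved) + S3b (flag-cost law) ⇒ the 3/2 rung. -/
theorem dualUnipotentThreeHalves_of (h1 : PermRankOfLineFlat) (h2 : GMSBound) (h3a : RunBound)
    (h3b : FlagCostLaw) : DualUnipotentThreeHalves :=
  dualUnipotentThreeHalves_of_slowPlane h1 h2 (slowPlane_of_flagCost h3a h3b)

/-- The target through the registered stubs (S3a discharged by `runBound_proof`). -/
theorem dualUnipotentThreeHalves_via_stubs : DualUnipotentThreeHalves :=
  dualUnipotentThreeHalves_of stub_permRank_of_lineFlat stub_gms runBound_proof stub_flagCostLaw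

/-- **The line, conditional on the Literature fact BY NAME** (S1 landed, S2 = GMS fact via `gmsBound_of_fact`,
S3a proved here): `GMS Cor 1.6 (ℂ) → FlagCostLaw → DualUnipotentThreeHalves`, no `sorry` on this path. -/
theorem dualUnipotentThreeHalves_of_fact
    (hF : Literature.LinearAlgebra.GutermanMeshulamSpiridonov2023_cor_1_6 ℂ) (h3b : FlagCostLaw) :
    DualUnipotentThreeHalves :=
  dualUnipotentThreeHalves_of stub_permRank_of_lineFlat (gmsBound_of_fact hF) runBound_proof h3b

/-- **The line in the kernel, fact-free:** crux 24318 ⟸ the LAW `FlagCostLaw` ALONE (S1, S2, S3a are theorems by name). -/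
theorem dualUnipotentThreeHalves_of_law (h3b : FlagCostLaw) : DualUnipotentThreeHalves :=
  dualUnipotentThreeHalves_of stub_permRank_of_lineFlat stub_gms runBound_proof h3b


/-! ## §5 Kernel inputs BY NAME (Negative lane, val-neg-2 g0) — the sandwich around `FlagCheap`

* `flagCheap_of_triangularisable` (p615665, Lemma (D) in flag currency): a STRICTLY TRIANGULARISABLE affine pencil
  with `16·m² ≤ n³`, `n ≥ 4` is flag-cheap — the light-top / triangularisable half of S3b is a kernel theorem;
  composed with `runBound_proof` it yields the slow-plane conclusion outright (`slowData_of_triangularisable`).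
* `nec_of_flagCheap` (p613488, NEC box of VERDICT #20 P1): flag-cheap ⇒ a direction space `K`, `(k+1)·n < dim K`,
  `k+2 ≤ n`, on which every linear part has nil-index `≤ k+1` — cancellation-free; a pencil with a SUPER-STEEP index
  profile (every direction space whose linear parts all have index `≤ j` has dimension `≤ j·n`, for all `j ≤ n-1`) in the
  scope `C₀·m² < n³` would REFUTE S3b through this theorem.
* `suf_flagCheap_of_top_pow_eq_zero` / `suf_flagCheap_of_top_index_lt` (p617241, SUF box): a direction space `K` with all
  linear parts of nil-index `≤ ν` and `(⌊(ν-1)n/ν⌋+1)·n < dim K` (in particular: generic top index `< n`) ⇒ flag-cheap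
  (line-dependent image flags, `p = ν`, `r = a = ν-1`).  KERNEL SANDWICH: NEC ⟸ FlagCheap ⟸ SUF; S3b / R2 have content
  exactly for pencils with a STEEP top-index profile (no low-index `K` above the SUF threshold), and are refuted by any
  in-scope pencil with a SUPER-STEEP one. -/

/-- Light-top, triangularisable case of S3b — KERNEL, by name (val-neg-2 g0, p615665). -/
theorem flagCheap_of_triangularisable {n m : ℕ} (N : AffMat n m) (hN : IsAffine N)
    (P : (Matrix (Fin m) (Fin m) ℂ)ˣ)
    (htri : ∀ i j : Fin m, j ≤ i →
      ((P : Matrix (Fin m) (Fin m) ℂ).map C * N * (↑P⁻¹ : Matrix (Fin m) (Fin m) ℂ).map C :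
        Matrix (Fin m) (Fin m) (MvPolynomial (Fin n × Fin n) ℂ)) i j = 0)
    (hmn : 16 * m ^ 2 ≤ n ^ 3) (hn : 4 ≤ n) : FlagCheap n m N :=
  Summit.ValiantsHypothesis.ValiantsHypothesis.Theorems.DualUnipotentThreeHalvesNegative.FlagCost.flagCheap_of_triangularisable
    N hN P htri hmn hn

/-- Triangularisable ⇒ the slow-plane data of S3, sorry-free (p615665 ∘ `runBound_proof`). -/
theorem slowData_of_triangularisable {n m : ℕ} (N : AffMat n m) (hN : IsAffine N)
    (P : (Matrix (Fin m) (Fin m) ℂ)ˣ)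
    (htri : ∀ i j : Fin m, j ≤ i →
      ((P : Matrix (Fin m) (Fin m) ℂ).map C * N * (↑P⁻¹ : Matrix (Fin m) (Fin m) ℂ).map C :
        Matrix (Fin m) (Fin m) (MvPolynomial (Fin n × Fin n) ℂ)) i j = 0)
    (hmn : 16 * m ^ 2 ≤ n ^ 3) (hn : 4 ≤ n) :
    ∃ (K : Submodule ℂ (Fin n × Fin n → ℂ)) (k : ℕ),
      (∀ x v : Fin n × Fin n → ℂ, v ∈ K → ∀ i j : Fin m,
        (((N.map (lineSubst x v)) ^ (n - 1)) i j).totalDegree ≤ k) ∧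
      (k + 1) * n < Module.finrank ℂ K :=
  runBound_proof n m N (flagCheap_of_triangularisable N hN P htri hmn hn)

/-- SUF box — KERNEL, by name (val-neg-2 g0, p617241): low-index linear parts on a large direction space ⇒ flag-cheap. -/
theorem suf_flagCheap_of_top_pow_eq_zero {n m : ℕ} (N : AffMat n m) (hN : IsAffine N)
    (K : Submodule ℂ (Fin n × Fin n → ℂ)) (ν : ℕ) (hν : 1 ≤ ν)
    (htop : ∀ v : Fin n × Fin n → ℂ, v ∈ K →
      (Matrix.of fun i j => ∑ c, v c * coeff (Finsupp.single c 1) (N i j)) ^ ν = 0)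
    (hbudget : ((ν - 1) * n / ν + 1) * n < Module.finrank ℂ K) : FlagCheap n m N :=
  Summit.ValiantsHypothesis.ValiantsHypothesis.Theorems.DualUnipotentThreeHalvesNegative.FlagCost.flagCheap_of_top_pow_eq_zero
    N hN K ν hν htop hbudget

/-- SUF box, generic-index form — KERNEL, by name (p617241): all linear parts of nil-index `ν < n` ⇒ flag-cheap;
composed with `runBound_proof`, such pencils carry the slow-plane data outright. -/
theorem suf_flagCheap_of_top_index_lt {n m : ℕ} (N : AffMat n m) (hN : IsAffine N) (ν : ℕ) (hν : 1 ≤ ν) (hνn : ν < n)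
    (htop : ∀ v : Fin n × Fin n → ℂ,
      (Matrix.of fun i j => ∑ c, v c * coeff (Finsupp.single c 1) (N i j)) ^ ν = 0) : FlagCheap n m N :=
  Summit.ValiantsHypothesis.ValiantsHypothesis.Theorems.DualUnipotentThreeHalvesNegative.FlagCost.flagCheap_of_top_index_lt
    N hN ν hν hνn htop

theorem slowData_of_top_index_lt {n m : ℕ} (N : AffMat n m) (hN : IsAffine N) (ν : ℕ) (hν : 1 ≤ ν) (hνn : ν < n)
    (htop : ∀ v : Fin n × Fin n → ℂ,
      (Matrix.of fun i j => ∑ c, v c * coeff (Finsupp.single c 1) (N i j)) ^ ν = 0) :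
    ∃ (K : Submodule ℂ (Fin n × Fin n → ℂ)) (k : ℕ),
      (∀ x v : Fin n × Fin n → ℂ, v ∈ K → ∀ i j : Fin m,
        (((N.map (lineSubst x v)) ^ (n - 1)) i j).totalDegree ≤ k) ∧
      (k + 1) * n < Module.finrank ℂ K :=
  runBound_proof n m N (suf_flagCheap_of_top_index_lt N hN ν hν hνn htop)

/-- NEC box — KERNEL, by name (val-neg-2 g0, p613488): flag-cheap ⇒ a large direction space of low-index linear parts. -/
theorem nec_of_flagCheap {n m : ℕ} (N : AffMat n m) (hN : IsAffine N) (h : FlagCheap n m N) :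
    ∃ (K : Submodule ℂ (Fin n × Fin n → ℂ)) (k : ℕ), (k + 1) * n < Module.finrank ℂ K ∧ k + 2 ≤ n ∧
      ∀ v : Fin n × Fin n → ℂ, v ∈ K →
        (Matrix.of fun i j => ∑ c, v c * coeff (Finsupp.single c 1) (N i j)) ^ (k + 1) = 0 :=
  Summit.ValiantsHypothesis.ValiantsHypothesis.Theorems.DualUnipotentThreeHalvesNegative.FlagCost.linPart_pow_eq_zero_of_flagCheap
    N hN h

end Summit.ValiantsHypothesis.ValiantsHypothesis.Cruxes.DualUnipotentThreeHalves.FlagCost
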